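import Summits.AtomisticToContinuum.HydrodynamicLimit.Theorems.ImplosionDichotomyPolynomialCompressionLevel3Defs
import Summits.AtomisticToContinuum.HydrodynamicLimit.Theorems.ImplosionDichotomyPolynomialCompressionLevel2Forcing
import Summits.AtomisticToContinuum.HydrodynamicLimit.Theorems.ImplosionDichotomyPolynomialCompressionSubTopBounds
import Summits.AtomisticToContinuum.HydrodynamicLimit.Theorems.ImplosionDichotomyPolynomialCompressionTorusJetCalculus
import Summits.AtomisticToContinuum.HydrodynamicLimit.Theorems.ImplosionDichotomyPolynomialCompressionIsentropicCalculus

/-!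
# Level-3 forcing minus its top-order part: crude pointwise bound, temperature component

Helper file for the line `log-lipschitz-budget` of the crux `ImplosionDichotomy.PolynomialCompression`
(stmt-AtomisticToContinuum-12587), stub `stub_logBudgetShadowing` (level-3 estimate, crude part). Temperature
analogue of `level3_crude_density` for `l3Fθ - l3Topθ` (`θζ(ρ) - θ₁ = δθ·ζ(ρ) + θ₁(ζ(ρ) - 1)`, the second term
being equation-of-state forcing with the small envelope `Z`).
-/

noncomputable section

namespace Summit.AtomisticToContinuum.HydrodynamicLimit.Theorems

open Set MeasureTheory
open Literature.MathematicalPhysics.KineticTheory Literature.Analysis.FunctionSpaces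

/-! ## Private helpers: linearity of iterated `Torus.partialDeriv` in the shapes of the level-3 identity -/

/-- Peeling the nested derivatives of the level-3 identity:
`∂ₙ[∂ₘ(∂ₗF - C_l) - C_m] = ∂ₙ∂ₘ∂ₗF - ∂ₙ∂ₘC_l - ∂ₙC_m`. [folklore] -/
private theorem l3ct_peel {F Cl Cm : T3 → ℝ} (hF : Torus.IsSmooth F) (hCl : Torus.IsSmooth Cl)
    (hCm : Torus.IsSmooth Cm) (l m n : Fin 3) (x : T3) :
    Torus.partialDeriv n (fun y₂ => Torus.partialDeriv m
        (fun y₁ => Torus.partialDeriv l F y₁ - Cl y₁) y₂ - Cm y₂) x =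
      Torus.partialDeriv n (Torus.partialDeriv m (Torus.partialDeriv l F)) x -
        Torus.partialDeriv n (Torus.partialDeriv m Cl) x - Torus.partialDeriv n Cm x := by
  obtain ⟨-, -, hsub, -, -⟩ := partialDeriv_iter_sum_sub
  have h1 : Torus.IsSmooth (fun y₁ => Torus.partialDeriv l F y₁ - Cl y₁) :=
    torusJet_isSmooth_sub (hF.partialDeriv l) hCl
  rw [torusJet_sub_deriv1 (h1.partialDeriv m) hCm n x, hsub (hF.partialDeriv l) hCl m n x]

/-- Order-3 linearity in the shape of the level-1 forcing `-(2/3)Q - E - Σᵢ Pᵢ`. [folklore] -/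
private theorem l3ct_lin3 {Q E : T3 → ℝ} {P : Fin 3 → T3 → ℝ} (hQ : Torus.IsSmooth Q)
    (hE : Torus.IsSmooth E) (hP : ∀ i, Torus.IsSmooth (P i)) (l m n : Fin 3) (x : T3) :
    Torus.partialDeriv n (Torus.partialDeriv m (Torus.partialDeriv l
        (fun y => -(2 / 3) * Q y - E y - ∑ i, P i y))) x =
      -(2 / 3) * Torus.partialDeriv n (Torus.partialDeriv m (Torus.partialDeriv l Q)) x -
        Torus.partialDeriv n (Torus.partialDeriv m (Torus.partialDeriv l E)) x -
        ∑ i, Torus.partialDeriv n (Torus.partialDeriv m (Torus.partialDeriv l (P i))) x := by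
  obtain ⟨-, hsum, -, hsub, hcm⟩ := partialDeriv_iter_sum_sub
  have h1 : Torus.IsSmooth (fun y => -(2 / 3) * Q y) := torusJet_isSmooth_const_mul hQ _
  have h2 : Torus.IsSmooth (fun y => -(2 / 3) * Q y - E y) := torusJet_isSmooth_sub h1 hE
  have h3 : Torus.IsSmooth (fun y => ∑ i, P i y) := torusJet_isSmooth_sum _ fun i _ => hP i
  rw [hsub h2 h3 l m n x, hsub h1 hE l m n x, hcm hQ _ l m n x, hsum _ (fun i _ => hP i) l m n x]

/-- Order-2 linearity in the shape of the commutator `Σᵢ aᵢ + (2/3) F G`. [folklore] -/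
private theorem l3ct_lin2 {a : Fin 3 → T3 → ℝ} {F G : T3 → ℝ} (ha : ∀ i, Torus.IsSmooth (a i))
    (hF : Torus.IsSmooth F) (hG : Torus.IsSmooth G) (m n : Fin 3) (x : T3) :
    Torus.partialDeriv n (Torus.partialDeriv m (fun y => ∑ i, a i y + 2 / 3 * F y * G y)) x =
      ∑ i, Torus.partialDeriv n (Torus.partialDeriv m (a i)) x +
        2 / 3 * Torus.partialDeriv n (Torus.partialDeriv m (fun y => F y * G y)) x := by
  obtain ⟨hsum, -, hsub, -, -⟩ := partialDeriv_iter_sum_sub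
  have e : (fun y => ∑ i, a i y + 2 / 3 * F y * G y) =
      fun y => (∑ i, a i y) - (-(2 / 3)) * (F y * G y) := by
    funext y; ring
  have h1 : Torus.IsSmooth (fun y => ∑ i, a i y) := torusJet_isSmooth_sum _ fun i _ => ha i
  have hFG : Torus.IsSmooth (fun y => F y * G y) := torusJet_isSmooth_mul hF hG
  have h2 : Torus.IsSmooth (fun y => (-(2 / 3)) * (F y * G y)) := torusJet_isSmooth_const_mul hFG _
  rw [e, hsub h1 h2 m n x, hsum _ (fun i _ => ha i) m n x,
    (Torus.partialDeriv₃_const_mul hFG (-(2 / 3)) m n n x).2.1]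
  ring

/-- Order-1 linearity in the shape of the commutator `Σᵢ bᵢ + (2/3) F G`. [folklore] -/
private theorem l3ct_lin1 {b : Fin 3 → T3 → ℝ} {F G : T3 → ℝ} (hb : ∀ i, Torus.IsSmooth (b i))
    (hF : Torus.IsSmooth F) (hG : Torus.IsSmooth G) (n : Fin 3) (x : T3) :
    Torus.partialDeriv n (fun y => ∑ i, b i y + 2 / 3 * F y * G y) x =
      ∑ i, Torus.partialDeriv n (b i) x + 2 / 3 * Torus.partialDeriv n (fun y => F y * G y) x := by
  have e : (fun y => ∑ i, b i y + 2 / 3 * F y * G y) =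
      fun y => (∑ i, b i y) + (2 / 3) * (F y * G y) := by
    funext y; ring
  have h1 : Torus.IsSmooth (fun y => ∑ i, b i y) := torusJet_isSmooth_sum _ fun i _ => hb i
  have hFG : Torus.IsSmooth (fun y => F y * G y) := torusJet_isSmooth_mul hF hG
  rw [e, torusJet_add_deriv1 h1 (torusJet_isSmooth_const_mul hFG _) n x,
    torusJet_sum_deriv1 _ (fun i _ => hb i) n x, torusJet_const_mul_deriv1 hFG (2 / 3) n x]

/-- The pure-real bookkeeping of the crude temperature bound: the seven remainder estimates imply
`|F - Top| ≤ l3Rem`. [folklore] -/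
private theorem l3ct_real {M Z S₂ S₃ d₀ d₁ d₂ q3 e3 tθ h1 fl2 Fl fm1 Fm Fn : ℝ}
    {p3 tu gθ a2 cl yθl yul b1 cm yθm yum cn yθn yun yun' : Fin 3 → ℝ}
    (hM : 0 ≤ M) (hS₂ : 0 ≤ S₂) (hS₃ : 0 ≤ S₃) (hd₀ : 0 ≤ d₀) (hd₁ : 0 ≤ d₁) (hd₂ : 0 ≤ d₂)
    (hq : |q3 - tθ * h1| ≤ 3 * (d₂ * M) + 3 * (d₁ * (M * (1 + S₂))) + d₀ * (M * (1 + S₂ + S₃)))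
    (he : |e3| ≤ Z * (1 + S₂ + S₃))
    (hp : ∀ i, |p3 i - tu i * gθ i| ≤ 3 * (d₂ * M) + 3 * (d₁ * (M * (1 + S₂))) + d₀ * (M * (1 + S₂ + S₃)))
    (ha : ∀ i, |a2 i - cl i * yθl i| ≤ 2 * (M * (1 + S₂) * d₂) + M * (1 + S₂ + S₃) * d₁)
    (hf : |fl2 - Fl * ∑ i, yul i| ≤ 2 * (M * (1 + S₂) * (3 * d₂)) + M * (1 + S₂ + S₃) * (3 * d₁))
    (hb : ∀ i, |b1 i - cm i * yθm i| ≤ M * (1 + S₂) * d₂)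
    (hg : |fm1 - Fm * ∑ i, yum i| ≤ M * (1 + S₂) * (3 * d₂))
    (hy : ∀ i, yun i = yun' i) :
    |-(2 / 3) * q3 - e3 - ∑ i, p3 i - (∑ i, a2 i + 2 / 3 * fl2) - (∑ i, b1 i + 2 / 3 * fm1) -
          (∑ i, cn i * yθn i + 2 / 3 * Fn * ∑ i, yun i) -
        (-(∑ i, tu i * gθ i) - 2 / 3 * tθ * h1 - (∑ i, cl i * yθl i + 2 / 3 * Fl * ∑ i, yul i) -
          (∑ i, cm i * yθm i + 2 / 3 * Fm * ∑ i, yum i) -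
          (∑ i, cn i * yθn i + 2 / 3 * Fn * ∑ i, yun' i))| ≤ l3Rem M Z S₂ S₃ d₀ d₁ d₂ := by
  simp only [Fin.sum_univ_three] at hf hg ⊢
  rw [hy 0, hy 1, hy 2]
  obtain ⟨hq1, hq2⟩ := abs_le.1 hq
  obtain ⟨he1, he2⟩ := abs_le.1 he
  obtain ⟨hp01, hp02⟩ := abs_le.1 (hp 0)
  obtain ⟨hp11, hp12⟩ := abs_le.1 (hp 1)
  obtain ⟨hp21, hp22⟩ := abs_le.1 (hp 2)
  obtain ⟨ha01, ha02⟩ := abs_le.1 (ha 0)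
  obtain ⟨ha11, ha12⟩ := abs_le.1 (ha 1)
  obtain ⟨ha21, ha22⟩ := abs_le.1 (ha 2)
  obtain ⟨hf1, hf2⟩ := abs_le.1 hf
  obtain ⟨hb01, hb02⟩ := abs_le.1 (hb 0)
  obtain ⟨hb11, hb12⟩ := abs_le.1 (hb 1)
  obtain ⟨hb21, hb22⟩ := abs_le.1 (hb 2)
  obtain ⟨hg1, hg2⟩ := abs_le.1 hg
  have n1 : 0 ≤ M * d₀ := mul_nonneg hM hd₀
  have n2 : 0 ≤ M * d₀ * S₂ := mul_nonneg n1 hS₂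
  have n3 : 0 ≤ M * d₀ * S₃ := mul_nonneg n1 hS₃
  have n4 : 0 ≤ M * d₁ := mul_nonneg hM hd₁
  have n5 : 0 ≤ M * d₁ * S₂ := mul_nonneg n4 hS₂
  have n6 : 0 ≤ M * d₁ * S₃ := mul_nonneg n4 hS₃
  have n7 : 0 ≤ M * d₂ := mul_nonneg hM hd₂
  have n8 : 0 ≤ M * d₂ * S₂ := mul_nonneg n7 hS₂
  unfold l3Rem
  rw [abs_le]
  constructor <;> linarith


/-- **Crude bound, temperature component.** [folklore] -/
theorem level3_crude_temperature :
    ∀ {σ T : ℝ} {ρ θ ρ₁ θ₁ : ℝ → T3 → ℝ} {u u₁ : ℝ → T3 → V3} {ζ : ℝ → ℝ} {J : Set ℝ} {t : ℝ} {x : T3}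
      {M Z S₂ S₃ d₀ d₁ d₂ : ℝ},
      IsHardSphereEulerSolution σ T ρ u θ → IsHardSphereEulerSolution 0 T ρ₁ u₁ θ₁ → IsOpen J →
      ContDiffOn ℝ (⊤ : ℕ∞) ζ J → (∀ s ∈ Ico 0 T, ∀ y, ρ s y ∈ J) →
      (∀ s ∈ Ico 0 T, ∀ y, hsPressure σ (ρ s y) (θ s y) = ρ s y * θ s y * ζ (ρ s y)) → t ∈ Ico 0 T →
      0 ≤ M → 0 ≤ Z → 0 ≤ S₂ → 0 ≤ S₃ → 0 ≤ d₀ → 0 ≤ d₁ → 0 ≤ d₂ →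
      Level3Coeff ζ ρ θ ρ₁ θ₁ u u₁ t x M Z S₂ S₃ → Level3Jets ρ θ ρ₁ θ₁ u u₁ t x d₀ d₁ d₂ →
      ∀ (l m n : Fin 3),
        |l3Fθ T ζ ρ θ θ₁ u u₁ t x l m n - l3Topθ ζ ρ θ θ₁ u u₁ t x l m n| ≤ l3Rem M Z S₂ S₃ d₀ d₁ d₂ := by
  intro σ T ρ θ ρ₁ θ₁ u u₁ ζ J t x M Z S₂ S₃ d₀ d₁ d₂ hE hE₁ hJ hζ hρJ hp ht hM _hZ hS₂ hS₃ hd₀ hd₁ hd₂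
    hC hJt l m n
  obtain ⟨hu1, hu2, hu3, -, -, -, -, -, hθζb, -, -, -, hθ₁b, -, -, hH1b, -, hE2b⟩ := hC
  obtain ⟨-, hδθ0, hδu0, -, hδθ1, hδu1, -, hδθ2, hδu2⟩ := hJt
  have hU0 : UniqueDiffOn ℝ (Ico (0 : ℝ) T) := uniqueDiffOn_Ico 0 T
  -- smooth slices
  have hρs : Torus.IsSmooth (ρ t) := hE.smooth_density.isSmooth_slice ht
  have hθs : Torus.IsSmooth (θ t) := hE.smooth_temperature.isSmooth_slice ht
  have hθ₁s : Torus.IsSmooth (θ₁ t) := hE₁.smooth_temperature.isSmooth_slice ht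
  have hus : Torus.IsSmooth (u t) := hE.smooth_velocity.isSmooth_slice ht
  have hu₁s : Torus.IsSmooth (u₁ t) := hE₁.smooth_velocity.isSmooth_slice ht
  have hUs : Torus.IsSmooth (fun z => u t z - u₁ t z) :=
    (hE.smooth_velocity.sub hE₁.smooth_velocity).isSmooth_slice ht
  have huis : ∀ i, Torus.IsSmooth (fun y => u t y i) := fun i => hus.apply i
  have hu₁is : ∀ i, Torus.IsSmooth (fun y => u₁ t y i) := fun i => hu₁s.apply i
  have hδθs : Torus.IsSmooth (fun y => θ t y - θ₁ t y) := torusJet_isSmooth_sub hθs hθ₁s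
  have hδus : ∀ i, Torus.IsSmooth (fun y => u t y i - u₁ t y i) := fun i =>
    torusJet_isSmooth_sub (huis i) (hu₁is i)
  have hζs : Torus.IsSmooth (fun y => ζ (ρ t y)) := torusJet_isSmooth_comp hJ hζ hρs fun y => hρJ t ht y
  have hθζs : Torus.IsSmooth (fun y => θ t y * ζ (ρ t y)) := torusJet_isSmooth_mul hθs hζs
  have hdivs : Torus.IsSmooth (fun y => ∑ i, Torus.partialDeriv i (fun z => u₁ t z i) y) :=
    torusJet_isSmooth_sum _ fun i _ => (hu₁is i).partialDeriv i
  have hH1s : Torus.IsSmooth (fun y => ζ (ρ t y) * ∑ i, Torus.partialDeriv i (fun z => u₁ t z i) y) :=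
    torusJet_isSmooth_mul hζs hdivs
  have hE2s : Torus.IsSmooth
      (fun y => 2 / 3 * (θ₁ t y * (ζ (ρ t y) - 1)) * ∑ i, Torus.partialDeriv i (fun z => u₁ t z i) y) :=
    torusJet_isSmooth_mul (torusJet_isSmooth_const_mul (torusJet_isSmooth_mul hθ₁s
      (torusJet_isSmooth_sub hζs (torusJet_isSmooth_const 1))) _) hdivs
  have hQs : Torus.IsSmooth
      (fun y => (θ t y - θ₁ t y) * (ζ (ρ t y) * ∑ i, Torus.partialDeriv i (fun z => u₁ t z i) y)) :=
    torusJet_isSmooth_mul hδθs hH1s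
  have hPs : ∀ i, Torus.IsSmooth (fun y => (u t y i - u₁ t y i) * Torus.partialDeriv i (θ₁ t) y) :=
    fun i => torusJet_isSmooth_mul (hδus i) (hθ₁s.partialDeriv i)
  have hgi : ∀ i, Torus.IsSmooth (Torus.partialDeriv i (fun y => (u t y - u₁ t y) i)) :=
    fun i => (hUs.apply i).partialDeriv i
  have hgs : Torus.IsSmooth (fun y => ∑ i, Torus.partialDeriv i (fun y => (u t y - u₁ t y) i) y) :=
    torusJet_isSmooth_sum _ fun i _ => hgi i
  have has : ∀ i, Torus.IsSmooth (fun y => Torus.partialDeriv l (fun y => u t y i) y *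
      Torus.partialDeriv i (fun y => θ t y - θ₁ t y) y) :=
    fun i => torusJet_isSmooth_mul ((huis i).partialDeriv l) (hδθs.partialDeriv i)
  have hbs : ∀ i, Torus.IsSmooth (fun y => Torus.partialDeriv m (fun y => u t y i) y *
      Torus.partialDeriv i (Torus.partialDeriv l (fun y => θ t y - θ₁ t y)) y) :=
    fun i => torusJet_isSmooth_mul ((huis i).partialDeriv m) ((hδθs.partialDeriv l).partialDeriv i)
  have hG2i : ∀ i, Torus.IsSmooth
      (Torus.partialDeriv i (fun y => Torus.partialDeriv l (fun z => u t z - u₁ t z) y i)) :=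
    fun i => ((hUs.partialDeriv l).apply i).partialDeriv i
  have hG2s : Torus.IsSmooth (fun y => ∑ i, Torus.partialDeriv i
      (fun y' => Torus.partialDeriv l (fun z => u t z - u₁ t z) y' i) y) :=
    torusJet_isSmooth_sum _ fun i _ => hG2i i
  have hFs : Torus.IsSmooth (fun y =>
      -(2 / 3) * ((θ t y - θ₁ t y) * (ζ (ρ t y) * ∑ i, Torus.partialDeriv i (fun z => u₁ t z i) y)) -
        2 / 3 * (θ₁ t y * (ζ (ρ t y) - 1)) * (∑ i, Torus.partialDeriv i (fun z => u₁ t z i) y) -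
        ∑ i, (u t y i - u₁ t y i) * Torus.partialDeriv i (θ₁ t) y) :=
    torusJet_isSmooth_sub (torusJet_isSmooth_sub (torusJet_isSmooth_const_mul hQs _) hE2s)
      (torusJet_isSmooth_sum _ fun i _ => hPs i)
  have hCls : Torus.IsSmooth (fun y₁ =>
      ∑ i, Torus.partialDeriv l (fun y => u t y i) y₁ * Torus.partialDeriv i (fun y => θ t y - θ₁ t y) y₁ +
        2 / 3 * Torus.partialDeriv l (fun y => θ t y * ζ (ρ t y)) y₁ *
          ∑ i, Torus.partialDeriv i (fun y => (u t y - u₁ t y) i) y₁) :=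
    torusJet_isSmooth_add (torusJet_isSmooth_sum _ fun i _ => has i)
      (torusJet_isSmooth_mul (torusJet_isSmooth_const_mul (hθζs.partialDeriv l) _) hgs)
  have hCms : Torus.IsSmooth (fun y₂ =>
      ∑ i, Torus.partialDeriv m (fun y => u t y i) y₂ *
          Torus.partialDeriv i (Torus.partialDeriv l (fun y => θ t y - θ₁ t y)) y₂ +
        2 / 3 * Torus.partialDeriv m (fun y => θ t y * ζ (ρ t y)) y₂ *
          ∑ i, Torus.partialDeriv i
            (fun y => Torus.partialDeriv l (fun z => u t z - u₁ t z) y i) y₂) :=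
    torusJet_isSmooth_add (torusJet_isSmooth_sum _ fun i _ => hbs i)
      (torusJet_isSmooth_mul (torusJet_isSmooth_const_mul (hθζs.partialDeriv m) _) hG2s)
  -- (a) the level-3 identity (one-step commutator applied to the level-2 forcing, reference law `ζ₂ ≡ 1`)
  have hp₁ : ∀ s ∈ Ico 0 T, ∀ y, hsPressure 0 (ρ₁ s y) (θ₁ s y) =
      ρ₁ s y * θ₁ s y * (fun _ : ℝ => (1 : ℝ)) (ρ₁ s y) := fun s _ y => hsPressure_zero_eq_ideal _ _
  have hw : Torus.IsSmoothSpaceTimeOn (Ico 0 T)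
      (fun s => Torus.partialDeriv m (Torus.partialDeriv l (fun y => u s y - u₁ s y))) :=
    ((hE.smooth_velocity.sub hE₁.smooth_velocity).partialDeriv hU0 l).partialDeriv hU0 m
  have hβ : Torus.IsSmoothSpaceTimeOn (Ico 0 T)
      (fun s => Torus.partialDeriv m (Torus.partialDeriv l (fun y => θ s y - θ₁ s y))) :=
    ((hE.smooth_temperature.sub hE₁.smooth_temperature).partialDeriv hU0 l).partialDeriv hU0 m
  have hJc := hsEuler_frozen_commutator_temperature
    (w := fun s => Torus.partialDeriv m (Torus.partialDeriv l (fun y => u s y - u₁ s y)))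
    (β := fun s => Torus.partialDeriv m (Torus.partialDeriv l (fun y => θ s y - θ₁ s y)))
    hE hζ hρJ hw hβ ht x n
  have hfeq : (fun y => -(∑ i, (u t y i - u₁ t y i) * Torus.partialDeriv i (θ₁ t) y) -
      2 / 3 * (θ t y * ζ (ρ t y) - θ₁ t y * 1) * ∑ i, Torus.partialDeriv i (fun z => u₁ t z i) y) =
      fun y => -(2 / 3) * ((θ t y - θ₁ t y) * (ζ (ρ t y) * ∑ i, Torus.partialDeriv i (fun z => u₁ t z i) y)) -
        2 / 3 * (θ₁ t y * (ζ (ρ t y) - 1)) * (∑ i, Torus.partialDeriv i (fun z => u₁ t z i) y) -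
        ∑ i, (u t y i - u₁ t y i) * Torus.partialDeriv i (θ₁ t) y := by
    funext y; ring
  have hfun : (fun y => Torus.timeDerivWithin (Ico 0 T)
          (fun s => Torus.partialDeriv m (Torus.partialDeriv l (fun y => θ s y - θ₁ s y))) t y +
        ∑ i, u t y i * Torus.partialDeriv i
          (Torus.partialDeriv m (Torus.partialDeriv l (fun y => θ t y - θ₁ t y))) y +
        2 / 3 * (θ t y * ζ (ρ t y)) * ∑ i, Torus.partialDeriv i (fun z =>
          (Torus.partialDeriv m (Torus.partialDeriv l (fun y => u t y - u₁ t y))) z i) y) =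
      fun y₂ => Torus.partialDeriv m (fun y₁ => Torus.partialDeriv l (fun y =>
          -(2 / 3) * ((θ t y - θ₁ t y) * (ζ (ρ t y) * ∑ i, Torus.partialDeriv i (fun z => u₁ t z i) y)) -
            2 / 3 * (θ₁ t y * (ζ (ρ t y) - 1)) * (∑ i, Torus.partialDeriv i (fun z => u₁ t z i) y) -
            ∑ i, (u t y i - u₁ t y i) * Torus.partialDeriv i (θ₁ t) y) y₁ -
          (∑ i, Torus.partialDeriv l (fun y => u t y i) y₁ *
              Torus.partialDeriv i (fun y => θ t y - θ₁ t y) y₁ +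
            2 / 3 * Torus.partialDeriv l (fun y => θ t y * ζ (ρ t y)) y₁ *
              ∑ i, Torus.partialDeriv i (fun y => (u t y - u₁ t y) i) y₁)) y₂ -
        (∑ i, Torus.partialDeriv m (fun y => u t y i) y₂ *
            Torus.partialDeriv i (Torus.partialDeriv l (fun y => θ t y - θ₁ t y)) y₂ +
          2 / 3 * Torus.partialDeriv m (fun y => θ t y * ζ (ρ t y)) y₂ *
            ∑ i, Torus.partialDeriv i
              (fun y => Torus.partialDeriv l (fun z => u t z - u₁ t z) y i) y₂) := by
    funext y₂
    rw [hsEuler_level2_forcing_temperature hE hE₁ hJ hζ hρJ hp isOpen_univ contDiffOn_const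
      (fun _ _ _ => mem_univ _) hp₁ ht y₂ l m, hfeq]
  unfold l3Fθ l3Topθ
  rw [hJc, hfun, l3ct_peel hFs hCls hCms l m n x, l3ct_lin3 hQs hE2s hPs l m n x, l3ct_lin2 has
    (hθζs.partialDeriv l) hgs m n x, l3ct_lin1 hbs (hθζs.partialDeriv m) hG2s n x]
  -- (b) coordinate conversions `(u - u₁) i = uᵢ - u₁ᵢ` under one and two derivatives
  have hc2 : ∀ i, (fun y => Torus.partialDeriv l (fun z => u t z - u₁ t z) y i) =
      Torus.partialDeriv l (fun y => u t y i - u₁ t y i) := by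
    intro i; funext y
    rw [← torusJet_apply_coord_deriv1 hUs i l y]
    simp only [PiLp.sub_apply]
  have hc3 : ∀ i, (fun y => Torus.partialDeriv m (Torus.partialDeriv l (fun z => u t z - u₁ t z)) y i) =
      Torus.partialDeriv m (Torus.partialDeriv l (fun y => u t y i - u₁ t y i)) := by
    intro i; funext y
    rw [← torusJet_apply_coord_deriv2 hUs i m l y]
    simp only [PiLp.sub_apply]
  -- (c) the seven remainder bounds
  have hq := (abs_partialDeriv_mul_sub_top_le' hδθs hH1s hδθ0 hδθ1 hδθ2 hH1b.zero hH1b.one hH1b.two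
    hH1b.three).2.2 l m n
  have he3 := hE2b.three l m n
  have hp3 := fun i => (abs_partialDeriv_mul_sub_top_le' (hδus i) (hθ₁s.partialDeriv i) (hδu0 i)
    (hδu1 i) (hδu2 i) (hθ₁b i).zero (hθ₁b i).one (hθ₁b i).two (hθ₁b i).three).2.2 l m n
  have ha2 := fun i => (abs_partialDeriv_mul_sub_top_le ((huis i).partialDeriv l) (hδθs.partialDeriv i)
    (hu1 i l) (hu2 i l) (hu3 i l) (fun j k o => Torus.abs_partialDeriv₃_le_dsize₃ _ x j k o) (hδθ1 i)
    (hδθ2 i) (fun j k => Torus.abs_partialDeriv₂_le_dsize₂ _ x j k)).2.1 m n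
  have hg0 : |∑ i, Torus.partialDeriv i (fun y => (u t y - u₁ t y) i) x| ≤ 3 * d₁ := by
    simp only [PiLp.sub_apply, Fin.sum_univ_three]
    exact (abs_add_three _ _ _).trans (by linarith [hδu1 0 0, hδu1 1 1, hδu1 2 2])
  have hg1 : ∀ j, |Torus.partialDeriv j
      (fun y => ∑ i, Torus.partialDeriv i (fun y => (u t y - u₁ t y) i) y) x| ≤ 3 * d₂ := by
    intro j
    rw [torusJet_sum_deriv1 _ (fun i _ => hgi i) j x]
    simp only [PiLp.sub_apply, Fin.sum_univ_three]
    exact (abs_add_three _ _ _).trans (by linarith [hδu2 0 0 j, hδu2 1 1 j, hδu2 2 2 j])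
  have hfl := (abs_partialDeriv_mul_sub_top_le (hθζs.partialDeriv l) hgs (hθζb.one l) (hθζb.two l)
    (hθζb.three l) (fun j k o => Torus.abs_partialDeriv₃_le_dsize₃ _ x j k o) hg0 hg1
    (fun j k => Torus.abs_partialDeriv₂_le_dsize₂ _ x j k)).2.1 m n
  have hgs2 : Torus.partialDeriv n (Torus.partialDeriv m
      (fun y => ∑ i, Torus.partialDeriv i (fun y => (u t y - u₁ t y) i) y)) x =
      ∑ i, Torus.partialDeriv n (Torus.partialDeriv m (Torus.partialDeriv i
        (fun y => u t y i - u₁ t y i))) x := by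
    rw [partialDeriv_iter_sum_sub.1 _ (fun i _ => hgi i) m n x]
    simp only [PiLp.sub_apply]
  rw [hgs2] at hfl
  have hb1 := fun i => (abs_partialDeriv_mul_sub_top_le ((huis i).partialDeriv m)
    ((hδθs.partialDeriv l).partialDeriv i) (hu1 i m) (hu2 i m) (hu3 i m)
    (fun j k o => Torus.abs_partialDeriv₃_le_dsize₃ _ x j k o) (hδθ2 l i)
    (fun j => Torus.abs_partialDeriv_le_dsize₁ _ x j) (fun j k => Torus.abs_partialDeriv₂_le_dsize₂ _ x j k)).1 n
  have hG20 : |∑ i, Torus.partialDeriv i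
      (fun y' => Torus.partialDeriv l (fun z => u t z - u₁ t z) y' i) x| ≤ 3 * d₂ := by
    have e : ∑ i, Torus.partialDeriv i (fun y' => Torus.partialDeriv l (fun z => u t z - u₁ t z) y' i) x =
        ∑ i, Torus.partialDeriv i (Torus.partialDeriv l (fun y => u t y i - u₁ t y i)) x :=
      Finset.sum_congr rfl fun i _ => by rw [hc2 i]
    rw [e]
    simp only [Fin.sum_univ_three]
    exact (abs_add_three _ _ _).trans (by linarith [hδu2 0 l 0, hδu2 1 l 1, hδu2 2 l 2])
  have hfm := (abs_partialDeriv_mul_sub_top_le (hθζs.partialDeriv m) hG2s (hθζb.one m) (hθζb.two m)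
    (hθζb.three m) (fun j k o => Torus.abs_partialDeriv₃_le_dsize₃ _ x j k o) hG20
    (fun j => Torus.abs_partialDeriv_le_dsize₁ _ x j) (fun j k => Torus.abs_partialDeriv₂_le_dsize₂ _ x j k)).1 n
  have hG2n : Torus.partialDeriv n (fun y => ∑ i, Torus.partialDeriv i
      (fun y' => Torus.partialDeriv l (fun z => u t z - u₁ t z) y' i) y) x =
      ∑ i, Torus.partialDeriv n (Torus.partialDeriv i (Torus.partialDeriv l
        (fun y => u t y i - u₁ t y i))) x := by
    rw [torusJet_sum_deriv1 _ (fun i _ => hG2i i) n x]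
    exact Finset.sum_congr rfl fun i _ => by rw [hc2 i]
  rw [hG2n] at hfm
  have hy : ∀ i, Torus.partialDeriv i (fun y => Torus.partialDeriv m (Torus.partialDeriv l
      (fun z => u t z - u₁ t z)) y i) x = Torus.partialDeriv i (Torus.partialDeriv m
      (Torus.partialDeriv l (fun y => u t y i - u₁ t y i))) x := fun i => by rw [hc3 i]
  exact l3ct_real hM hS₂ hS₃ hd₀ hd₁ hd₂ hq he3 hp3 ha2 hfl hb1 hfm hy

end Summit.AtomisticToContinuum.HydrodynamicLimit.Theorems

end
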